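import Literature.Geometry.Kaehler.BlowUpDefectSlices
import Mathlib.Analysis.Calculus.BumpFunction.InnerProduct
import HarnessLib

/-!
# The ball pieces of the defect currents as normal rectifiable currents on `V`

Continuation of `BlowUpDefect.lean` / `BlowUpDefectSlices.lean`. For a holomorphic `p`-chain `T`
(`p = q + 1`) on `Ω`, `b ∈ Ω`, a holomorphic `p`-chain `C` on `V` and radii `0 < r`, `0 < t < 1`,
the piece of the defect current over the ball `𝐁(0,t)`, read as a current on the whole space,

`P_{r,t} = D_r ⌞ 𝐁(0,t) − [C] ⌞ 𝐁(0,t) = [A_{b,r}⁻¹(car T) ∩ 𝐁(0,t), θ_T ∘ A, ξ_T ∘ A] − [car C ∩ 𝐁(0,t), θ_C, ξ_C] ∈ 𝓡_{2p}(V)`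

(`HolomorphicChain.blowUpPiece` minus the cut-down current of `C`), is what Federer's compactness
theorem [Federer1969, 4.2.17] is applied to in the passage from weak to flat convergence of the
blow-ups [Federer1969, 4.3.16]. This file proves:

* `Current.mass_boundary_le_of_comp_monoCLM` — **the boundary mass of a current on `V` supported
  inside `Ω'` is at most the boundary mass of its restriction to `Ω'`** (cut the test form off by
  a smooth function `≡ 1` near the support);
* `HolomorphicChain.isRectifiable_ballPiece`, `…support_ballPiece_subset`,
  `…exists_mass_ballPiece_le` — `P_{r,t}` is rectifiable with `spt ⊆ 𝐁̄(0,t)` and has uniformly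
  bounded mass;
* `HolomorphicChain.ballPiece_comp_monoCLM` — restricted to the unit ball, `P_{r,t}` is
  `D_r ⌞ 𝐁(0,t) − [C]⌞𝐁(0,1) ⌞ 𝐁(0,t)`; `…ballPiece_monoCLM_apply` — so it agrees with the defect
  current `D_r − [C]⌞𝐁(0,1)` on test forms supported in `𝐁(0,t)`;
* `HolomorphicChain.exists_ballPiece_normalMass_le` — **uniformly normal rectifiable ball
  pieces**: for `0 < ρ₁ < ρ₂ < 1` there is `c < ∞` such that for all small `r > 0` some
  `t ∈ (ρ₁, ρ₂)` gives a rectifiable `P_{r,t}` with `spt P_{r,t} ⊆ 𝐁̄(0,ρ₂)` and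
  `𝐍(P_{r,t}) ≤ c`, agreeing with `D_r − [C]⌞𝐁(0,1)` on forms supported in `𝐁(0,ρ₁)`.

What is then still needed for the flat form of King's theorem
(`Literature.Geometry.Kaehler.King1971_tangentCone`): the rectifiability of `∂P_{r,t}` (Federer's
boundary rectifiability theorem 4.2.16 (2), not in this tree) to make the pieces integral, and the
compactness theorem `Federer1969_compactness_integralCurrents`.

Theorems only; no new definitions, no named facts.

## References

* H. Federer, *Geometric Measure Theory*, Springer 1969, 4.1.7, 4.2.17, 4.3.16–4.3.18
  [Federer1969].
* R. Harvey, *Holomorphic chains and their boundaries*, PSPUM XXX.1 (1977), §1.10, Thm. 1.31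
  [Harvey1977].
-/

noncomputable section

open scoped Manifold Topology ENNReal NNReal InnerProductSpace ContDiff Distributions
open Set Filter MeasureTheory Metric Function Module TopologicalSpace

/-! ### Boundary mass and restriction to an open subset -/

namespace Literature.Geometry.GeometricMeasureTheory

-- Nested operator-norm instances on (duals of) `E [⋀^Fin n]→L[ℝ] ℝ`.
set_option maxSynthPendingDepth 2

section BoundaryMass

variable {E : Type*} [NormedAddCommGroup E] [NormedSpace ℝ E] [FiniteDimensional ℝ E]
  {Ω' : Opens E} {k : ℕ}

/-- A current does not see a change of the test form away from its support. [cite: Federer1969, 4.1.1] -/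
private theorem Current.apply_eq_of_eqOn {m : ℕ} {Ω : Opens E} (P : Current Ω m) {U : Set E}
    (hU : IsOpen U) (hPU : P.support ⊆ U) {ω₁ ω₂ : TestForm Ω m} (h : EqOn ⇑ω₁ ⇑ω₂ U) :
    P ω₁ = P ω₂ := by
  rw [← sub_eq_zero, ← map_sub]
  refine P.apply_eq_zero_of_disjoint_support (disjoint_left.2 fun x hx hxP => ?_)
  have hsub : tsupport ⇑(ω₁ - ω₂) ⊆ Uᶜ := by
    refine (closure_mono fun y hy => ?_).trans (subset_of_eq hU.isClosed_compl.closure_eq)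
    intro hyU
    exact hy (show (ω₁ - ω₂) y = 0 by rw [show (ω₁ - ω₂) y = ω₁ y - ω₂ y from rfl, h hyU, sub_self])
  exact hsub hx (hPU hxP)

/-- **The boundary mass of a current on `E` supported inside `Ω'` is at most the boundary mass of
its restriction to `Ω'`**: given a smooth `χ` with `|χ| ≤ 1`, compactly supported in `Ω'` and
`≡ 1` on an open `U ⊇ spt P`, every `∂P(φ) = P(d(χφ)) = ∂(P|Ω')(χφ)`. [cite: Federer1969, 4.1.7] -/
theorem Current.mass_boundary_le_of_comp_monoCLM (P : Current (⊤ : Opens E) (k + 1))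
    {U : Set E} (hU : IsOpen U) (hPU : P.support ⊆ U) {χ : E → ℝ} (hχ : ContDiff ℝ ∞ χ)
    (hχc : HasCompactSupport χ) (hχΩ : tsupport χ ⊆ (Ω' : Set E)) (hχU : ∀ x ∈ U, χ x = 1)
    (hχ1 : ∀ x, |χ x| ≤ 1) :
    P.boundary.mass ≤
      (Current.boundary (P.comp (TestFunction.monoCLM ℝ) : Current Ω' (k + 1))).mass := by
  refine iSup₂_le fun φ hφ => ?_
  -- the cut-off form `χ φ` as a test form on `Ω'`
  set ψ : TestForm Ω' k := ⟨fun x => χ x • φ x, hχ.smul φ.contDiff, hχc.smul_right,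
    (tsupport_smul_subset_left _ _).trans hχΩ⟩ with hψdef
  have hψ : ∀ x, ‖ψ x‖ ≤ 1 := fun x => by
    show ‖χ x • φ x‖ ≤ 1
    rw [norm_smul, Real.norm_eq_abs]
    calc |χ x| * ‖φ x‖ ≤ 1 * 1 :=
          mul_le_mul (hχ1 x) (hφ x) (norm_nonneg _) zero_le_one
      _ = 1 := one_mul 1
  have hmono : (TestFunction.monoCLM ℝ ψ : TestForm (⊤ : Opens E) k) = TestForm.smulFun hχ φ := by
    apply TestFunction.ext; intro x
    rw [TestForm.monoCLM_apply_of_le (show Ω' ≤ (⊤ : Opens E) from le_top)]; rfl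
  -- `d(χ φ) = dφ` on `U`
  have hd : EqOn ⇑(TestForm.extDerivCLM φ) ⇑(TestForm.extDerivCLM (TestForm.smulFun hχ φ)) U := by
    intro x hx
    have hfd : fderiv ℝ χ x = 0 := by
      have hev : χ =ᶠ[𝓝 x] fun _ => (1 : ℝ) :=
        Filter.eventuallyEq_of_mem (hU.mem_nhds hx) fun y hy => hχU y hy
      rw [hev.fderiv_eq, fderiv_const_apply]
    have h0 : (fderiv ℝ χ x).smulRight (φ x) = 0 := by
      rw [hfd]; ext v; simp
    rw [TestForm.extDerivCLM_smulFun]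
    show TestForm.extDerivCLM φ x =
      TestForm.wedgeD hχ φ x + TestForm.smulFun hχ (TestForm.extDerivCLM φ) x
    have hz : ContinuousAlternatingMap.alternatizeUncurryFin (0 : E →L[ℝ] Covector E k) = 0 :=
      (ContinuousAlternatingMap.alternatizeUncurryFinCLM ℝ E ℝ).map_zero
    rw [TestForm.wedgeD_apply, TestForm.smulFun_apply, hχU x hx, one_smul, h0, hz, zero_add]
  have hval : P.boundary φ =
      Current.boundary (P.comp (TestFunction.monoCLM ℝ) : Current Ω' (k + 1)) ψ := by
    rw [Current.boundary_apply, Current.boundary_apply, ContinuousLinearMap.comp_apply,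
      ← TestForm.extDerivCLM_monoCLM (show Ω' ≤ (⊤ : Opens E) from le_top), hmono]
    exact P.apply_eq_of_eqOn hU hPU hd
  rw [hval]
  exact Current.ofReal_apply_le_mass _ hψ

end BoundaryMass

end Literature.Geometry.GeometricMeasureTheory

namespace Literature.Geometry.Kaehler

open Literature.Geometry.GeometricMeasureTheory

-- Nested operator-norm instances on (duals of) `V [⋀^Fin n]→L[ℝ] ℝ`.
set_option maxSynthPendingDepth 2

universe u

variable {V : Type u} [NormedAddCommGroup V] [InnerProductSpace ℂ V] [FiniteDimensional ℂ V]

namespace HolomorphicChain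

variable [MeasurableSpace V] [BorelSpace V] {Ω : Opens V} {q : ℕ}
  (T : HolomorphicChain 𝓘(ℂ, V) Ω (q + 1)) (C : HolomorphicChain 𝓘(ℂ, V) (⊤ : Opens V) (q + 1))

/-! ### The ball pieces `P_{r,t}` on `V` -/

/-- **`P_{r,t}` is rectifiable** (`0 < r`, `B(b,r) ⊆ Ω`, `0 < t < 1`): both currents of
integration have admissible data on `V` and support in the compact ball `𝐁̄(0,t)`.
[cite: Federer1969, 4.1.28, 4.3.16] -/
theorem isRectifiable_ballPiece {b : V} {r : ℝ} (hr : 0 < r) (hball : ball b r ⊆ (Ω : Set V))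
    {t : ℝ} (ht1 : t < 1) :
    letI : InnerProductSpace ℝ V := InnerProductSpace.complexToReal
    (T.blowUpPiece b r (ball (0 : V) t) -
      currentOfIntegration (C.carrier ∩ ball (0 : V) t) C.density C.orientationFrame :
        Current (⊤ : Opens V) (2 * (q + 1))).IsRectifiable := by
  letI : InnerProductSpace ℝ V := InnerProductSpace.complexToReal
  haveI : FiniteDimensional ℝ V := FiniteDimensional.complexToReal V
  have hD := T.isRectifiableData_blowUpPiece hr hball measurableSet_ball ht1
    (ball_subset_closedBall (x := (0 : V)) (ε := t))
  have hC := (Harvey1977_isRectifiableData_toCurrent_holds V (⊤ : Opens V) (q + 1) C).inter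
    (measurableSet_ball (x := (0 : V)) (ε := t))
  have hK : IsCompact (closedBall (0 : V) t) := isCompact_closedBall _ _
  refine Current.IsRectifiable.sub_top ⟨⟨_, _, _, hD, rfl⟩, ?_⟩ ⟨⟨_, _, _, hC, rfl⟩, ?_⟩
  · exact Current.isCompact_support_of_subset _ hK (subset_univ _)
      ((support_currentOfIntegration_subset_closure _ _ _).trans
        (closure_minimal (inter_subset_right.trans ball_subset_closedBall) isClosed_closedBall))
  · exact Current.isCompact_support_of_subset _ hK (subset_univ _)
      ((support_currentOfIntegration_subset_closure _ _ _).trans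
        (closure_minimal (inter_subset_right.trans ball_subset_closedBall) isClosed_closedBall))

omit [FiniteDimensional ℂ V] in
/-- **`spt P_{r,t} ⊆ 𝐁̄(0,t)`.** [cite: Federer1969, 4.1.1] -/
theorem support_ballPiece_subset (b : V) (r t : ℝ) :
    (T.blowUpPiece b r (ball (0 : V) t) -
      currentOfIntegration (C.carrier ∩ ball (0 : V) t) C.density C.orientationFrame :
        Current (⊤ : Opens V) (2 * (q + 1))).support ⊆ closedBall (0 : V) t := by
  letI : InnerProductSpace ℝ V := InnerProductSpace.complexToReal
  have h1 : (T.blowUpPiece b r (ball (0 : V) t)).support ⊆ closedBall (0 : V) t :=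
    (support_currentOfIntegration_subset_closure _ _ _).trans
      (closure_minimal (inter_subset_right.trans ball_subset_closedBall) isClosed_closedBall)
  have h2 : (currentOfIntegration (C.carrier ∩ ball (0 : V) t) C.density C.orientationFrame :
      Current (⊤ : Opens V) (2 * (q + 1))).support ⊆ closedBall (0 : V) t :=
    (support_currentOfIntegration_subset_closure _ _ _).trans
      (closure_minimal (inter_subset_right.trans ball_subset_closedBall) isClosed_closedBall)
  rw [sub_eq_add_neg]
  refine (Current.support_add_subset _ _).trans (union_subset h1 ?_)
  rwa [Current.support_neg]

/-- **Uniform mass bound for the pieces**: there is `M < ∞` with `𝐌(P_{r,t}) ≤ M` for all small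
`r > 0` and all `0 < t ≤ 1` (Lelong's density bounds for the blow-ups and for `C`).
[cite: Harvey1977, §1.10; Federer1969, 4.3.16] -/
theorem exists_mass_ballPiece_le {b : V} (hb : b ∈ (Ω : Set V)) :
    ∃ M : ℝ≥0∞, M ≠ ⊤ ∧ ∀ᶠ r in 𝓝[>] (0 : ℝ), ∀ t : ℝ, 0 < t → t ≤ 1 →
      (T.blowUpPiece b r (ball (0 : V) t) -
        currentOfIntegration (C.carrier ∩ ball (0 : V) t) C.density C.orientationFrame :
          Current (⊤ : Opens V) (2 * (q + 1))).mass ≤ M := by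
  letI : InnerProductSpace ℝ V := InnerProductSpace.complexToReal
  obtain ⟨R, hR, hRΩ⟩ := Metric.isOpen_iff.1 Ω.isOpen b hb
  set R₁ : ℝ := R / 3 with hR₁
  have hR₁0 : 0 < R₁ := by positivity
  have hball3 : ball b (3 * R₁) ⊆ (Ω : Set V) := by
    rw [hR₁, show 3 * (R / 3) = R by ring]; exact hRΩ
  obtain ⟨Cd, hCdtop, hCd⟩ := T.exists_lintegral_blowUpDensity_ball_le' hR₁0 hball3
  obtain ⟨Cc, hCctop, hCc⟩ := C.exists_lintegral_density_ball_le' (b := (0 : V)) (R₁ := 1) one_pos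
    (by simp)
  refine ⟨Cd * ENNReal.ofReal 1 + Cc * ENNReal.ofReal 1, ENNReal.add_ne_top.2
    ⟨ENNReal.mul_ne_top hCdtop ENNReal.ofReal_ne_top, ENNReal.mul_ne_top hCctop ENNReal.ofReal_ne_top⟩,
    ?_⟩
  filter_upwards [Ioo_mem_nhdsGT (half_pos hR₁0)] with r hr t ht0 ht1
  have hballr : ball b r ⊆ (Ω : Set V) := (ball_subset_ball (by linarith [hr.2])).trans hball3
  have hD : (T.blowUpPiece b r (ball (0 : V) t)).mass ≤ Cd * ENNReal.ofReal 1 := by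
    by_cases ht : t < 1
    · have hdata := T.isRectifiableData_blowUpPiece hr.1 hballr measurableSet_ball ht
        (ball_subset_closedBall (x := (0 : V)) (ε := t))
      refine (show (T.blowUpPiece b r (ball (0 : V) t)).mass ≤ _ from hdata.mass_le).trans ?_
      refine (hCd r hr.1 hr.2.le 0 (mem_closedBall_self zero_le_one) t ht0 ht1).trans ?_
      gcongr
      exact pow_le_one₀ ht0.le ht1
    · have ht' : t = 1 := le_antisymm ht1 (not_lt.1 ht)
      subst ht'
      have hdata := T.isRectifiableData_blowUp (Harvey1977_isRectifiableData_toCurrent_holds V Ω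
        (q + 1) T) hr.1 hballr
      -- on the whole unit ball the piece is `D_r` read on `V`; bound its mass by the density bound
      have hle : (T.blowUpPiece b r (ball (0 : V) 1)).mass ≤
          ∫⁻ x in T.blowUpSet b r ∩ ball (0 : V) 1, ‖(T.blowUpDensity b r x : ℝ)‖ₑ
            ∂(μHE[2 * (q + 1)] : Measure V) :=
        mass_currentOfIntegration_le _ _ _ (hdata.2.2.2.2.mono fun _ hx => norm_frameVector_le_one hx.1)
      refine hle.trans ((hCd r hr.1 hr.2.le 0 (mem_closedBall_self zero_le_one) 1 one_pos le_rfl).trans ?_)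
      simp
  have hC : (currentOfIntegration (C.carrier ∩ ball (0 : V) t) C.density C.orientationFrame :
      Current (⊤ : Opens V) (2 * (q + 1))).mass ≤ Cc * ENNReal.ofReal 1 := by
    have hdata := (Harvey1977_isRectifiableData_toCurrent_holds V (⊤ : Opens V) (q + 1) C).inter
      (measurableSet_ball (x := (0 : V)) (ε := t))
    refine hdata.mass_le.trans ((hCc 0 (mem_closedBall_self zero_le_one) t ht0 ht1).trans ?_)
    gcongr
    exact pow_le_one₀ ht0.le ht1
  calc (T.blowUpPiece b r (ball (0 : V) t) -
        currentOfIntegration (C.carrier ∩ ball (0 : V) t) C.density C.orientationFrame :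
          Current (⊤ : Opens V) (2 * (q + 1))).mass
      = (T.blowUpPiece b r (ball (0 : V) t) +
          -currentOfIntegration (C.carrier ∩ ball (0 : V) t) C.density C.orientationFrame :
            Current (⊤ : Opens V) (2 * (q + 1))).mass := by rw [sub_eq_add_neg]
    _ ≤ (T.blowUpPiece b r (ball (0 : V) t)).mass +
          (-currentOfIntegration (C.carrier ∩ ball (0 : V) t) C.density C.orientationFrame :
            Current (⊤ : Opens V) (2 * (q + 1))).mass := Current.mass_add_le _ _
    _ ≤ Cd * ENNReal.ofReal 1 + Cc * ENNReal.ofReal 1 := by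
        rw [Current.mass_neg]; exact add_le_add hD hC

/-- **Restricted to the unit ball, `P_{r,t} = D_r ⌞ 𝐁(0,t) − [C]⌞𝐁(0,1) ⌞ 𝐁(0,t)`** (`t < 1`).
[cite: Federer1969, 4.1.7] -/
theorem ballPiece_comp_monoCLM {b : V} {r : ℝ} (hr : 0 < r) (hball : ball b r ⊆ (Ω : Set V))
    {t : ℝ} (ht1 : t < 1) :
    ((T.blowUpPiece b r (ball (0 : V) t) -
      currentOfIntegration (C.carrier ∩ ball (0 : V) t) C.density C.orientationFrame :
        Current (⊤ : Opens V) (2 * (q + 1))).comp (TestFunction.monoCLM ℝ) :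
          Current (unitBall V) (2 * (q + 1))) =
      (T.isRepresentable_blowUp hr hball).restrictSet (ball (0 : V) t) measurableSet_ball -
        C.isRepresentable_toCurrentIn_unitBall.restrictSet (ball (0 : V) t) measurableSet_ball := by
  letI : InnerProductSpace ℝ V := InnerProductSpace.complexToReal
  have hD := T.isRectifiableData_blowUpPiece hr hball measurableSet_ball ht1
    (ball_subset_closedBall (x := (0 : V)) (ε := t))
  have hC := (Harvey1977_isRectifiableData_toCurrent_holds V (⊤ : Opens V) (q + 1) C).inter
    (measurableSet_ball (x := (0 : V)) (ε := t))
  have hle : unitBall V ≤ (⊤ : Opens V) := le_top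
  have hsetD : T.blowUpSet b r ∩ ball (0 : V) 1 ∩ ball (0 : V) t = T.blowUpSet b r ∩ ball (0 : V) t := by
    rw [inter_assoc, inter_eq_right.2 (ball_subset_ball ht1.le)]
  have hsetC : C.carrier ∩ ball (0 : V) 1 ∩ ball (0 : V) t = C.carrier ∩ ball (0 : V) t := by
    rw [inter_assoc, inter_eq_right.2 (ball_subset_ball ht1.le)]
  rw [ContinuousLinearMap.sub_comp, T.restrictSet_blowUp_eq hr hball, C.restrictSet_toCurrentIn_unitBall_eq,
    hsetD, hsetC, blowUpPiece, ← currentOfIntegration_eq_comp_monoCLM hle hD.2.2.2.1,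
    ← currentOfIntegration_eq_comp_monoCLM hle hC.2.2.2.1]

/-- **`P_{r,t}` agrees with the defect current `D_r − [C]⌞𝐁(0,1)` on test forms supported in
`𝐁(0,t)`.** [cite: Federer1969, 4.1.7] -/
theorem ballPiece_monoCLM_apply {b : V} {r : ℝ} (hr : 0 < r) (hball : ball b r ⊆ (Ω : Set V))
    {t : ℝ} (ht1 : t < 1) (ψ : TestForm (unitBall V) (2 * (q + 1)))
    (hψ : tsupport ⇑ψ ⊆ ball (0 : V) t) :
    (T.blowUpPiece b r (ball (0 : V) t) -
      currentOfIntegration (C.carrier ∩ ball (0 : V) t) C.density C.orientationFrame :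
        Current (⊤ : Opens V) (2 * (q + 1))) (TestFunction.monoCLM ℝ ψ) =
      (T.blowUp b r - C.toCurrentIn (unitBall V)) ψ := by
  have h := congrArg (fun S : Current (unitBall V) (2 * (q + 1)) => S ψ)
    (T.ballPiece_comp_monoCLM C hr hball ht1)
  simp only [ContinuousLinearMap.comp_apply] at h
  rw [h]
  simp only [FunLike.coe_sub, Pi.sub_apply]
  rw [(T.isRepresentable_blowUp hr hball).restrictSet_apply_of_support_subset _
      ((subset_tsupport _).trans hψ),
    C.isRepresentable_toCurrentIn_unitBall.restrictSet_apply_of_support_subset _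
      ((subset_tsupport _).trans hψ)]

/-- **The boundary mass of `P_{r,t}` on `V` is at most the boundary mass of its two pieces on the
unit ball** (`t < 1`: cut test forms off by a bump function `≡ 1` on `𝐁̄(0,t')`, `t < t' < 1`).
[cite: Federer1969, 4.1.7] -/
theorem mass_boundary_ballPiece_le {b : V} {r : ℝ} (hr : 0 < r) (hball : ball b r ⊆ (Ω : Set V))
    {t : ℝ} (ht0 : 0 < t) (ht1 : t < 1) :
    (Current.boundary (T.blowUpPiece b r (ball (0 : V) t) -
      currentOfIntegration (C.carrier ∩ ball (0 : V) t) C.density C.orientationFrame :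
        Current (⊤ : Opens V) (2 * q + 1 + 1))).mass ≤
      (Current.boundary ((T.isRepresentable_blowUp hr hball).restrictSet (ball (0 : V) t)
          measurableSet_ball : Current (unitBall V) (2 * q + 1 + 1))).mass +
        (Current.boundary (C.isRepresentable_toCurrentIn_unitBall.restrictSet (ball (0 : V) t)
          measurableSet_ball : Current (unitBall V) (2 * q + 1 + 1))).mass := by
  letI : InnerProductSpace ℝ V := InnerProductSpace.complexToReal
  haveI : FiniteDimensional ℝ V := FiniteDimensional.complexToReal V
  -- a bump function `≡ 1` on `𝐁̄(0, t')`, supported in `𝐁̄(0, t'')`, `t < t' < t'' < 1`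
  set t' : ℝ := (2 * t + 1) / 3 with ht'
  set t'' : ℝ := (t + 2) / 3 with ht''
  have htt' : t < t' := by rw [ht']; linarith
  have ht't'' : t' < t'' := by rw [ht', ht'']; linarith
  have ht''1 : t'' < 1 := by rw [ht'']; linarith
  let χb : ContDiffBump (0 : V) := ⟨t', t'', by linarith, ht't''⟩
  have hU : IsOpen (ball (0 : V) t') := isOpen_ball
  have hPU : (T.blowUpPiece b r (ball (0 : V) t) -
      currentOfIntegration (C.carrier ∩ ball (0 : V) t) C.density C.orientationFrame :
        Current (⊤ : Opens V) (2 * q + 1 + 1)).support ⊆ ball (0 : V) t' :=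
    (T.support_ballPiece_subset C b r t).trans (closedBall_subset_ball htt')
  have hχΩ : tsupport (χb : V → ℝ) ⊆ ((unitBall V : Opens V) : Set V) := by
    rw [χb.tsupport_eq]
    exact closedBall_subset_ball ht''1
  have hle := Current.mass_boundary_le_of_comp_monoCLM (Ω' := unitBall V) _ hU hPU χb.contDiff
    χb.hasCompactSupport hχΩ (fun x hx => χb.one_of_mem_closedBall (ball_subset_closedBall hx))
    (fun x => by rw [abs_of_nonneg χb.nonneg]; exact χb.le_one)
  refine hle.trans ?_
  rw [show ((T.blowUpPiece b r (ball (0 : V) t) -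
      currentOfIntegration (C.carrier ∩ ball (0 : V) t) C.density C.orientationFrame :
        Current (⊤ : Opens V) (2 * q + 1 + 1)).comp (TestFunction.monoCLM ℝ) :
          Current (unitBall V) (2 * q + 1 + 1)) = _ from T.ballPiece_comp_monoCLM C hr hball ht1,
    sub_eq_add_neg, Current.boundary_add, Current.boundary_neg]
  exact (Current.mass_add_le _ _).trans (by rw [Current.mass_neg])

/-! ### Uniformly normal rectifiable ball pieces -/

/-- **Uniformly normal rectifiable ball pieces of the defect currents** [Federer1969, 4.3.16 via
4.2.1]: for a holomorphic `p`-chain `T` (`p = q + 1`), `b ∈ Ω`, any holomorphic `p`-chain `C` on `V`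
and `0 < ρ₁ < ρ₂ < 1` there is `c < ∞` such that for all small `r > 0` some `t ∈ (ρ₁, ρ₂)` gives
a rectifiable current `P_{r,t} = D_r ⌞ 𝐁(0,t) − [C] ⌞ 𝐁(0,t)` on `V` with `spt P_{r,t} ⊆ 𝐁̄(0,ρ₂)`,
`𝐍(P_{r,t}) ≤ c`, agreeing with `D_r − [C]⌞𝐁(0,1)` on every test form supported in `𝐁(0,ρ₁)`.
[cite: Federer1969, 4.2.1, 4.2.17, 4.3.16; Harvey1977, Thm. 1.31] -/
theorem exists_ballPiece_normalMass_le {b : V} (hb : b ∈ (Ω : Set V)) {ρ₁ ρ₂ : ℝ} (h0 : 0 < ρ₁)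
    (h12 : ρ₁ < ρ₂) (h2 : ρ₂ < 1) :
    letI : InnerProductSpace ℝ V := InnerProductSpace.complexToReal
    ∃ c : ℝ≥0∞, c ≠ ⊤ ∧ ∀ᶠ r in 𝓝[>] (0 : ℝ), ∃ t ∈ Ioo ρ₁ ρ₂,
      (T.blowUpPiece b r (ball (0 : V) t) -
        currentOfIntegration (C.carrier ∩ ball (0 : V) t) C.density C.orientationFrame :
          Current (⊤ : Opens V) (2 * q + 1 + 1)).IsRectifiable ∧
      (T.blowUpPiece b r (ball (0 : V) t) -
        currentOfIntegration (C.carrier ∩ ball (0 : V) t) C.density C.orientationFrame :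
          Current (⊤ : Opens V) (2 * q + 1 + 1)).support ⊆ closedBall (0 : V) ρ₂ ∧
      (T.blowUpPiece b r (ball (0 : V) t) -
        currentOfIntegration (C.carrier ∩ ball (0 : V) t) C.density C.orientationFrame :
          Current (⊤ : Opens V) (2 * q + 1 + 1)).normalMass ≤ c ∧
      ∀ ψ : TestForm (unitBall V) (2 * (q + 1)), tsupport ⇑ψ ⊆ ball (0 : V) ρ₁ →
        (T.blowUpPiece b r (ball (0 : V) t) -
          currentOfIntegration (C.carrier ∩ ball (0 : V) t) C.density C.orientationFrame :
            Current (⊤ : Opens V) (2 * (q + 1))) (TestFunction.monoCLM ℝ ψ) =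
          (T.blowUp b r - C.toCurrentIn (unitBall V)) ψ := by
  obtain ⟨M, hMtop, hM⟩ := T.exists_mass_ballPiece_le C hb
  obtain ⟨c, hctop, hc⟩ := T.exists_ball_restrictSet_boundary_mass_le C hb h0 h12
  obtain ⟨R, hR, hRΩ⟩ := Metric.isOpen_iff.1 Ω.isOpen b hb
  refine ⟨M + c, ENNReal.add_ne_top.2 ⟨hMtop, hctop⟩, ?_⟩
  filter_upwards [hM, hc, Ioo_mem_nhdsGT hR] with r hMr hcr hrR
  obtain ⟨t, ht, hD, hC, hbd⟩ := hcr
  have ht0 : 0 < t := h0.trans ht.1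
  have ht1 : t < 1 := ht.2.trans h2
  have hballr : ball b r ⊆ (Ω : Set V) := (ball_subset_ball hrR.2.le).trans hRΩ
  refine ⟨t, ht, T.isRectifiable_ballPiece C hrR.1 hballr ht1,
    (T.support_ballPiece_subset C b r t).trans (closedBall_subset_closedBall ht.2.le), ?_,
    fun ψ hψ => T.ballPiece_monoCLM_apply C hrR.1 hballr ht1 ψ (hψ.trans (ball_subset_ball ht.1.le))⟩
  unfold Current.normalMass
  exact add_le_add (hMr t ht0 ht1.le)
    ((T.mass_boundary_ballPiece_le C hrR.1 hballr ht0 ht1).trans hbd)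

end HolomorphicChain

end Literature.Geometry.Kaehler
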